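/-
Copyright: statement-level skeleton of a published paper (lit-balaban cell, Phase-2 proof seat p26 gen 28). No claims beyond
what the kernel checks below.
-/
import Mathlib
import Literature.MathematicalPhysics.QuantumFieldTheory.Balaban1983to89.B3Eq312Member
import Literature.MathematicalPhysics.QuantumFieldTheory.Balaban1983to89.B3Sect3Subtraction319
import Literature.MathematicalPhysics.QuantumFieldTheory.Balaban1983to89.B3Sect3VectorSelfEnergy

/-!
# B3 — T. Bałaban, *(Higgs)₂,₃ quantum fields in a finite volume. III. Renormalization*, CMP **88** (1983) 411–445
[Balaban1983Higgs3] — pp. 439–442 [PDF 29–32]: the lowest-order vector self-energy graphs **(3.25)₁,₂** and the two generalized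
graphs of the graphical equation **(3.30)** as WORKED MEMBERS of the family of generalized graphs of Proposition 2.2 (seat p18 gen
7's `famK`); and the pictures **(3.7)/(3.8)** and **(3.30)** identified with r15's typed expressions `expr39` / `lhs326`

statement-level skeleton of published theorems with citation tags; proofs where landed; nothing here is a claim about
the Yang–Mills mass gap

PDF held: `paper:balaban1983-higgs-2-3-quantum-fields-finite-volume` (journal page = PDF page + 410); pp. 417, 435, 439–442 [PDF 7,
25, 29–32] read in the OCR text (`p0025.txt`, `p0029.txt`–`p0031.txt`) and on the ×2 renders
`run/shared/lean/pub/pub-balaban/b2b-balaban-ref1/pages/1983-cmp88-higgs23-III/1983-cmp88-higgs23-III-p007,p025,p032-x2.png` (the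
pictures (3.6)–(3.8), (3.25), (3.30)–(3.32), the displays (3.9), (3.26), (3.31), the counterterm convention of p. 417).

CITATION HEADER (lean-in-tree rule).  lit-balaban TYPED SKELETON (HOME `run/shared/lean/pub/lit-balaban/`), PHASE 2, seat p26
gen 28, file 2 of 2 (file 1 `B3Eq312Member`: the generic two-vertex datum `bubble δ`, its block calculus `degQ_one/two`,
`degQK_one/two`, `block_cases`, the exponents `κ312 = (3/2, 0)`, `memberOf`, and the graph (3.8) `graph38` with (3.12)); free
target `lit-balaban-r15/B3-CLOSURE.md` v1.1 §5 item 3 (*"the (3.30)–(3.32) and (3.7)/(3.8) pictures as drawn objects … with their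
expressions identified with r15's `expr39`/`lhs326`/`expr331`"*).  ROWS **B3.Eq3.25-3.32** (pictures (3.25)₁,₂, the two generalized
graphs of (3.30), the graphical equations (3.30)/(3.32)), **B3.Eq3.6-3.9** (pictures (3.6)₁/(3.7)₁/(3.8) as expressions) and
**B3.Prop2.2** (worked members) of `HOME/lit-balaban-r15/ROWS-B3.md` (fold owner r15, referee ref-4).  CONSUMES BY NAME: file 1;
p18 gen 7's family (`famK`, `prop21_freeLines`) at `B3Prop22FreeLinesExample.paramsK24`; p18 gen 3's readings
`B3Sect3LowestOrderGraphs.g325a/g325b` (`g325a_deg`, `g325b_deg`); r15's typed displays (3.9) `B3Sect3ScalarSelfEnergy.expr39`/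
`graphTerm39`/`counterTerm39`/`coeff39`, (3.19) `B3Sect3Subtraction319.subtracted319`, (3.26) `B3Sect3VectorSelfEnergy.lhs326`/
`eq326`/`bracket326_eq_Pi2`/`curly1_eq_Pi3`/`curly2`, (3.31) `eq331`.

THE PRINTED TEXT (verbatim).  p. 435 [PDF 25]: *"the renormalized class G_ren contains the corresponding mass renormalization
counterterms also: (−1)·[picture], (−1)·[picture], (−1)·[picture] (3.7) … We will consider in detail an expression corresponding
to [picture − picture] (3.8) … The expression corresponding to (3.8) is [(3.9)]"*; p. 417 [PDF 7]: *"δm²_G … will be represented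
by the same graph G but with both external legs localized in x and with the summation over x′."*; p. 439 [PDF 29]: *"The next
class of graphs is the class of self-energy graphs for vector fields. The graphs of lowest order are [four pictures] (3.25)"*;
p. 440 [PDF 30]: *"The expressions in the last curly bracket above are the generalized expressions of the same form as in (3.11),
they have positive degree −d + 3 + α and can be analyzed as in (3.13), (3.14), and Proposition 2.2 can be applied."*; p. 442
[PDF 32]: *"Let us write the effect of the above transformations in the following graphical form [(3.25)₁ + (3.25)₂ + (3.25)₃ +
(3.25)₄ = (3.25)₁ with +(1+α), −(1+α) + (3.25)₂ with +(1+α), −(1+α) + (vertex ∿×→∿) + (vertex ∿×∿)] (3.30) where the coefficient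
at the vertex ∿×→∿ is bounded, and the coefficient at the vertex ∿×∿ is proportional to (L^{j₀}η)^{−d+2}, and j₀ is the lowest
j-index of the external legs. The other primitively divergent graphs are considered in a simpler way, because they have degree 0.
We write [(3.31)] and the first term on the right side is convergent. … we can represent graphically the equality (3.31) in the
form [bubble = bubble with +α, −α + vertex ∿×∿] (3.32)"*.

WHAT IS TYPED / PROVED (conventions of file 1: `d = 3`, vertices `x = 0`, `x′ = 1`, lines `x → x′`, `−½` per leg and `−1` per
differentiation on a line; external legs and the `−(1+α)` derivative on an external leg live in the amplitude's vertex functions).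
§1 **(3.25)₁** as `graph325a` (each φ′-line differentiated once, at opposite vertices — the kernels `(G∂^{η*}_{μ′})(x,x′)`,
`(G∂^{η*}_μ)(x′,x)` of the first term of (3.26): `a = −2, −2`; `W = −1 = g325a_deg 3`; primitively divergent: `D(G′₁) = 1`,
`D(G′) = −1`) and the first generalized graph of (3.30) `memberK330a` (`κ = (3/2, 0)`): `D_K(G′₁) ∈ {5/2, 1}`, **`D_K(G′) = ½ =
−d + 3 + α`** (p. 440), r15's PRINTED hypothesis through positivity (`posSubgraphsExcept24_memberK330a`), (1.33) by
`prop21_freeLines` (`ineq133_memberK330a`).  **(3.25)₂** (one φ′-line through both differentiated legs — the kernel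
`(∂^η_{μ′}G∂^{η*}_μ)(x′,x)` of the second term of (3.26) —, one plain φ′-line) has THE SAME count datum as (3.8) (`graph325b_eq_graph38`,
`rfl`: p19's counts record legs, differentiations and η-powers, not the scalar/vector type of a line), `W = −1 = g325b_deg 3`, and
its (3.30) generalized graph is file 1's `memberK312` (`memberK330b`, `ineq133_memberK330b`).  **(3.25)₃,₄** as the one-vertex
count data `graph325c`/`graph325d` (one loop, `a = −1` / `−2`, η-powers `0` / `1`; `D = −1` = `g325c_deg 3`/`g325d_deg 3`, via p19's
one-vertex closed form `degQ_relabel_of_before_eq_univ_oneVertex`): both A′-legs sit at one point, so their expressions are the LOCAL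
terms T₃, T₄ of (3.26) (r15's `term3`, `term4`) and enter (3.30) only through the vertex ∿×∿ (§2); no generalized graph.
§2 EXPRESSIONS.  **(3.8) = (3.6)₁ + (3.7)₁ on r15's carrier**: with the kernel `Σ₃₉(x,x′) = c(x,x′)·q²` of the graph (3.6)₁
(`sigma39`; `c` = r15's `coeff39`), r15's graph-with-counterterm form `subtracted319 η Σ₃₉ φ φ′` of (3.19) — graph term with the legs
at `x, x′` minus the counterterm with both legs localized in `x` (p. 417), carrying the (−1) of (3.7) — has graph term `graphTerm39`
and counterterm `counterTerm39` (`subtracted319_sigma39`), and **`expr39 = −subtracted319 η Σ₃₉ φ φ′`** (`expr39_eq_neg_subtracted319`: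
(3.9) is minus that form — its exterior sign).  **(3.30) term by term in the scale indices** (`eq330_termwise`): r15's (3.26)
`eq326` regrouped as the four pictures of the right side of (3.30) — the local vertex ∿×∿ with coefficient `Π_{μμ′}`
(`bracket326_eq_Pi2`), the local vertex ∿×→∿ with coefficient `Π_{μμ′ν}` and the differentiated leg `∂^η_ν(g′A′_{μ′})`
(`curly1_eq_Pi3`), and the two generalized graphs = the Taylor-remainder pairing `curly2` (count data `memberK330a`, `memberK330b`).
(3.32) is r15's `eq331` verbatim (Hölder leg = the bubble `+α, −α`; local term = the vertex ∿×∿); its count-level content for a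
degree-0 primitively divergent graph is p18 gen 8's `B3Eq320PositiveSubgraphs.posSubgraphsExcept24_of_degZero` — nothing added here.
HONEST SCOPE: as file 1 (abstract-amplitude family `famK`; `d = 3`); the resummation over `j, j′, j″ ≤ j₀` and the vanishing
(3.27)–(3.29) producing the printed COEFFICIENTS of the two vertices of (3.30) are other cells of row B3.Eq3.25-3.32 (p39, p20, p03) —
`eq330_termwise` is the identity at fixed scale indices.  D-0026: definitions with bodies (two patterns, three data, two members, one
kernel) + theorems; no named facts, no `sorry`; standard axioms.  Unit `lit-balaban-p26` gen 28 (literature-prover-lit-balaban-p26-g28-0),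
HOME `run/shared/lean/pub/lit-balaban/`, 2026-08-22.
-/

open Finset

namespace Literature.MathematicalPhysics.QuantumFieldTheory.Balaban1983to89.B3Eq330Members

section Members

open B3Ineq215 B3Ineq213 B3Sect2FirstEstimate B3Prop1 B3FreeLine B3TwoVertexBlocks B3Eq312Member

/-- kernel: an element of `Fin 2` is `0` or `1`. [folklore] -/
private theorem fin_two_eq (i : Fin 2) : i = 0 ∨ i = 1 := by
  fin_cases i <;> simp

/-! ## §1 The graphs (3.25)₁,₂ and the two generalized graphs of (3.30) -/

/-- The differentiation pattern of (3.25)₁: the vertex `x` differentiates the line `0`, the vertex `x′` the line `1` (two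
φ′-lines, each from the differentiated leg of one vertex to the undifferentiated leg of the other: the kernels
`(G∂^{η*}_{μ′})(x,x′)`, `(G∂^{η*}_μ)(x′,x)` of the first term of (3.26)). [cite: Balaban1983Higgs3, (3.25) p.439] -/
def δ325a : Fin 2 → Fin 2 → ℕ := fun v l => if v = l then 1 else 0

/-- **The graph (3.25)₁** p. 439 [PDF 29] as a count datum (p18's reading `B3Sect3LowestOrderGraphs.g325a`: two (1.8)_{1,0} joined
by two φ′-lines each carrying one differentiation, the two A′-legs external). [cite: Balaban1983Higgs3, (3.25) p.439] -/
noncomputable def graph325a : Counts (Fin 2) 2 := bubble δ325a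

/-- **(2.14)** for (3.25)₁: both lines have dimension `−1 − 1 = −2`. [cite: Balaban1983Higgs3, (2.14) p.427] -/
theorem lineDimQ_graph325a (l : Fin 2) : lineDimQ graph325a l = -2 := by
  rw [graph325a, lineDimQ_bubble]
  rcases fin_two_eq l with h | h <;> subst h <;> norm_num [δ325a]

/-- **(3.25) "(D = −d + 2)"** for its first picture, on the count datum: `W = 3 + 0 + 0 − 2 − 2 = −1`. [cite: Balaban1983Higgs3, (3.25) p.439] -/
theorem wholeDeg_graph325a :
    (graph325a.d : ℚ) + graph325a.etaPow 0 + graph325a.etaPow 1 + ∑ l, lineDimQ graph325a l = -1 := by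
  have hd : graph325a.d = 3 := rfl
  have he : ∀ v, graph325a.etaPow v = 0 := fun _ => rfl
  rw [Fin.sum_univ_two, lineDimQ_graph325a, lineDimQ_graph325a, hd, he, he]
  norm_num

/-- The two degree counts of the tree agree: `W` = p18 gen 3's catalogue degree `2 − d` of (3.25)₁ at `d = 3`. [cite: Balaban1983Higgs3, (3.25) p.439] -/
theorem wholeDeg_graph325a_eq_deg (nbar : ℕ) (hn : 1 ≤ nbar) :
    (graph325a.d : ℚ) + graph325a.etaPow 0 + graph325a.etaPow 1 + ∑ l, lineDimQ graph325a l =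
      (B3Sect3LowestOrderGraphs.g325a nbar hn).deg 3 := by
  rw [wholeDeg_graph325a, B3Sect3LowestOrderGraphs.g325a_deg]; norm_num

/-- (3.25)₁ is primitively divergent: its proper subgraphs `G′₁` (one singly differentiated line with both vertices) have degree
`3 − 2 = 1 > 0` along either ordering, while the whole graph has degree `−1`. [cite: Balaban1983Higgs3, (3.25) p.439] -/
theorem degQ_one_graph325a (σ : Equiv.Perm (Fin 2)) : degQ (relabelCounts graph325a σ) 1 0 = 1 := by
  rw [graph325a, degQ_one δ325a σ, ← graph325a, lineDimQ_graph325a]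
  norm_num

/-- `D(G′) = −1` for (3.25)₁ along either ordering. [cite: Balaban1983Higgs3, (3.25) p.439] -/
theorem degQ_two_graph325a (σ : Equiv.Perm (Fin 2)) : degQ (relabelCounts graph325a σ) 2 0 = -1 := by
  rw [graph325a, degQ_two δ325a σ, ← graph325a, lineDimQ_graph325a, lineDimQ_graph325a]
  norm_num

/-- **The first generalized graph of (3.30)** — (3.25)₁ with `+(1+α)` on the loop — **is a member of the family of Proposition 2.2**
(`famK` at `paramsK24`) at every size bound `mb ≥ 2`. [cite: Balaban1983Higgs3, (3.30) p.442] -/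
noncomputable abbrev memberK330a (Cmax CD : ℝ) {mb : ℕ} (h : 2 ≤ mb) : CGraphK (paramsK24 Cmax CD) mb :=
  memberOf δ325a κ312 Cmax CD (κ312_mem_menu Cmax CD) h

/-- The generalized degrees of the proper blocks of the first graph of (3.30): `1 + 3/2 = 5/2` if the weighted line is shrunk
first, `1` otherwise — positive. [cite: Balaban1983Higgs3, (3.30) p.442] -/
theorem degQK_one_graph325a (σ : Equiv.Perm (Fin 2)) :
    degQK (relabelCounts graph325a σ) (κ312 ∘ σ) 1 0 = if σ 0 = 0 then 5 / 2 else 1 := by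
  rw [graph325a, degQK_one δ325a κ312 σ, ← graph325a, lineDimQ_graph325a]
  unfold κ312
  split_ifs <;> norm_num

/-- **p. 440 "they have positive degree −d + 3 + α and … Proposition 2.2 can be applied"**: `D_K(G′) = −1 + 3/2 = ½ = −3 + 3 + ½`
for the first generalized graph of (3.30), along either ordering. [cite: Balaban1983Higgs3, (3.26) p.440] -/
theorem degQK_two_graph325a (σ : Equiv.Perm (Fin 2)) : degQK (relabelCounts graph325a σ) (κ312 ∘ σ) 2 0 = 1 / 2 := by
  rw [graph325a, degQK_two δ325a κ312 σ, ← graph325a, lineDimQ_graph325a, lineDimQ_graph325a]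
  norm_num [κ312]

/-- Every non-trivial block of the first generalized graph of (3.30) has positive generalized degree. [cite: Balaban1983Higgs3, (3.30) p.442] -/
theorem degQK_block_pos_graph325a {σ : Equiv.Perm (Fin 2)} {i : Fin 3} {b : Fin 2}
    (hb : b ∈ (relabelCounts graph325a σ).toModel.reps (i : ℕ)) (hn : (relabelCounts graph325a σ).toModel.Nontriv (i : ℕ) b) :
    0 < degQK (relabelCounts graph325a σ) (κ312 ∘ σ) i b := by
  obtain ⟨hi, rfl⟩ := block_cases δ325a hb hn
  rcases hi with hi | hi
  · rw [hi, degQK_one_graph325a]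
    split_ifs <;> norm_num
  · rw [hi, degQK_two_graph325a]
    norm_num

/-- **The PRINTED hypothesis of Propositions 2.1/2.2 HOLDS for the first generalized graph of (3.30), through positivity.**
[cite: Balaban1983Higgs3, Prop. 2.2 p.428] -/
theorem posSubgraphsExcept24_memberK330a (Cmax CD : ℝ) {mb : ℕ} (h : 2 ≤ mb) (D : DatumK (paramsK24 Cmax CD)) :
    PosSubgraphsExcept24 (expansionK (paramsK24 Cmax CD) mb D) (memberK330a Cmax CD h) := by
  refine ⟨trivial, ?_⟩
  show ∀ H : Component graph325a,
    Is24K (relabelCounts graph325a H.1) (κ312 ∘ H.1) H.2.1 H.2.2.1 ∨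
      0 < degQK (relabelCounts graph325a H.1) (κ312 ∘ H.1) H.2.1 H.2.2.1
  rintro ⟨σ, i, b, hb, hn⟩
  exact Or.inr (degQK_block_pos_graph325a hb hn)

/-- … with every subgraph degree positive. [cite: Balaban1983Higgs3, (3.30) p.442] -/
theorem posSubgraphs_memberK330a (Cmax CD : ℝ) {mb : ℕ} (h : 2 ≤ mb) (D : DatumK (paramsK24 Cmax CD)) :
    ∀ H : (expansionK (paramsK24 Cmax CD) mb D).Sub (memberK330a Cmax CD h),
      0 < (expansionK (paramsK24 Cmax CD) mb D).subDeg (memberK330a Cmax CD h) H := by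
  show ∀ H : Component graph325a, 0 < degQK (relabelCounts graph325a H.1) (κ312 ∘ H.1) H.2.1 H.2.2.1
  rintro ⟨σ, i, b, hb, hn⟩
  exact degQK_block_pos_graph325a hb hn

/-- **(1.33) for the first generalized graph of (3.30)**, by `prop21_freeLines` — *"Proposition 2.2 can be applied"* (p. 440).
[cite: Balaban1983Higgs3, Prop. 2.2 p.428] -/
theorem ineq133_memberK330a (Cmax CD : ℝ) (mbar : ℕ → ℕ) (nbar : ℕ) (h : 2 ≤ mbar nbar) (α₀ : ℝ) (h0 : 0 < α₀)
    (h1 : α₀ < 1) :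
    ∃ δ₀ C : ℝ, 0 < δ₀ ∧ 0 < C ∧ ∀ D : DatumK (paramsK24 Cmax CD),
      Ineq133At (famK (paramsK24 Cmax CD) mbar nbar D).toExpansion
        ((famK (paramsK24 Cmax CD) mbar nbar D).single (memberK330a Cmax CD h)) α₀ δ₀ C := by
  obtain ⟨δ₀, hδ₀, H⟩ := prop21_freeLines (paramsK24 Cmax CD) mbar
  obtain ⟨C, hC, HC⟩ := H α₀ h0 h1 nbar
  exact ⟨δ₀, C, hδ₀, hC, fun D => HC D _ (posSubgraphsExcept24_memberK330a Cmax CD h D)⟩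

/-- The differentiation pattern of (3.25)₂: both vertices differentiate the line `0` (the φ′-line joining the two differentiated
legs: the kernel `(∂^η_{μ′}G∂^{η*}_μ)(x′,x)` of the second term of (3.26)); the second φ′-line is plain. [cite: Balaban1983Higgs3, (3.25) p.439] -/
def δ325b : Fin 2 → Fin 2 → ℕ := fun _ l => if l = 0 then 1 else 0

/-- **The graph (3.25)₂** (p18's reading `B3Sect3LowestOrderGraphs.g325b`) **has the count datum of (3.8)**: p19's counts record
legs, differentiations and η-powers, not the scalar/vector type of a line (both have dimension `−(d−2)/2` per leg, p. 422).
[cite: Balaban1983Higgs3, (3.25) p.439] -/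
theorem graph325b_eq_graph38 : bubble δ325b = graph38 := rfl

/-- `W = −1` for (3.25)₂ = p18 gen 3's catalogue degree `2 − d` of the second picture of (3.25) at `d = 3`. [cite: Balaban1983Higgs3, (3.25) p.439] -/
theorem wholeDeg_graph325b_eq_deg (nbar : ℕ) (hn : 1 ≤ nbar) :
    ((bubble δ325b).d : ℚ) + (bubble δ325b).etaPow 0 + (bubble δ325b).etaPow 1 + ∑ l, lineDimQ (bubble δ325b) l =
      (B3Sect3LowestOrderGraphs.g325b nbar hn).deg 3 := by
  rw [graph325b_eq_graph38, wholeDeg_graph38, B3Sect3LowestOrderGraphs.g325b_deg]; norm_num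

/-- **The second generalized graph of (3.30)** — (3.25)₂ with `+(1+α)` on the loop — is, as a member of `famK`, the member
`memberK312` of (3.12) (same count datum, same exponents); its hypothesis and (1.33) are `posSubgraphsExcept24_memberK312`,
`ineq133_memberK312`. [cite: Balaban1983Higgs3, (3.30) p.442] -/
noncomputable abbrev memberK330b (Cmax CD : ℝ) {mb : ℕ} (h : 2 ≤ mb) : CGraphK (paramsK24 Cmax CD) mb :=
  memberK312 Cmax CD h

/-- (1.33) for the second generalized graph of (3.30). [cite: Balaban1983Higgs3, Prop. 2.2 p.428] -/
theorem ineq133_memberK330b (Cmax CD : ℝ) (mbar : ℕ → ℕ) (nbar : ℕ) (h : 2 ≤ mbar nbar) (α₀ : ℝ) (h0 : 0 < α₀)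
    (h1 : α₀ < 1) :
    ∃ δ₀ C : ℝ, 0 < δ₀ ∧ 0 < C ∧ ∀ D : DatumK (paramsK24 Cmax CD),
      Ineq133At (famK (paramsK24 Cmax CD) mbar nbar D).toExpansion
        ((famK (paramsK24 Cmax CD) mbar nbar D).single (memberK330b Cmax CD h)) α₀ δ₀ C :=
  ineq133_memberK312 Cmax CD mbar nbar h α₀ h0 h1

/-! ### (3.25)₃,₄: the two tadpoles (one vertex, one loop) — local kernels, absorbed in the vertex ∿×∿ of (3.30) -/

/-- **The graph (3.25)₃** (p18's `g325c`): ONE vertex (1.10)_{2,0} (η-power `d + 2 − 2 − d = 0`) with its two φ′-legs joined by a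
plain loop line (`a = −1`), both A′-legs external at that vertex — its expression is the LOCAL term T₃ of (3.26) (r15's `term3`).
[cite: Balaban1983Higgs3, (3.25) p.439] -/
noncomputable def graph325c : Counts (Fin 1) 1 where
  src := fun _ => 0
  tgt := fun _ => 0
  touches := fun v => ⟨0, Or.inl (Subsingleton.elim _ _)⟩
  diffOn := fun _ _ => 0
  vecLegAvg := fun _ _ => 0
  etaPow := fun _ => 0
  d := 3
  L := 2
  δ₁ := 1
  d_pos := by norm_num
  two_le_L := le_rfl
  δ₁_pos := one_pos

/-- **The graph (3.25)₄** (p18's `g325d`): ONE vertex (1.8)_{2,0} (η-power `d + 2 − 1 − d = 1`) with its two φ′-legs joined by a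
loop line through the differentiated leg (`a = −1 − 1 = −2`), both A′-legs external — the LOCAL term T₄ of (3.26) (r15's `term4`,
kernel `η(G∂^{η*}_μ)(x,x)`). [cite: Balaban1983Higgs3, (3.25) p.439] -/
noncomputable def graph325d : Counts (Fin 1) 1 where
  src := fun _ => 0
  tgt := fun _ => 0
  touches := fun v => ⟨0, Or.inl (Subsingleton.elim _ _)⟩
  diffOn := fun _ _ => 1
  vecLegAvg := fun _ _ => 0
  etaPow := fun _ => 1
  d := 3
  L := 2
  δ₁ := 1
  d_pos := by norm_num
  two_le_L := le_rfl
  δ₁_pos := one_pos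

/-- **(2.14)** for the loop of (3.25)₃: two legs at the vertex, no differentiation, `a = −1`. [cite: Balaban1983Higgs3, (2.14) p.427] -/
theorem lineDimQ_graph325c : lineDimQ graph325c 0 = -1 := by
  unfold lineDimQ legExpQ Counts.legsOn
  rw [Fin.sum_univ_one]
  norm_num [graph325c]

/-- **(2.14)** for the loop of (3.25)₄: two legs at the vertex, one differentiation, `a = −2`. [cite: Balaban1983Higgs3, (2.14) p.427] -/
theorem lineDimQ_graph325d : lineDimQ graph325d 0 = -2 := by
  unfold lineDimQ legExpQ Counts.legsOn
  rw [Fin.sum_univ_one]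
  norm_num [graph325d]

/-- **(3.25) "(D = −d + 2)"** for the third picture: the whole (and only non-trivial) block has `D = e_x + a = 0 − 1 = −1` along the
ordering. [cite: Balaban1983Higgs3, (3.25) p.439] -/
theorem degQ_one_graph325c (σ : Equiv.Perm (Fin 1)) : degQ (relabelCounts graph325c σ) 1 0 = -1 := by
  rw [degQ_relabel_of_before_eq_univ_oneVertex graph325c σ (by rw [before_oneVertex]; decide), Fin.sum_univ_one,
    lineDimQ_graph325c]
  norm_num [graph325c]

/-- **(3.25) "(D = −d + 2)"** for the fourth picture: `D = e_x + a = 1 − 2 = −1`. [cite: Balaban1983Higgs3, (3.25) p.439] -/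
theorem degQ_one_graph325d (σ : Equiv.Perm (Fin 1)) : degQ (relabelCounts graph325d σ) 1 0 = -1 := by
  rw [degQ_relabel_of_before_eq_univ_oneVertex graph325d σ (by rw [before_oneVertex]; decide), Fin.sum_univ_one,
    lineDimQ_graph325d]
  norm_num [graph325d]

/-- The two degree counts of the tree agree for (3.25)₃: `W = e_x + a` = p18's catalogue degree `2 − d` at `d = 3`.
[cite: Balaban1983Higgs3, (3.25) p.439] -/
theorem wholeDeg_graph325c_eq_deg (nbar : ℕ) (hn : 2 ≤ nbar) :
    (graph325c.etaPow 0 : ℚ) + ∑ l, lineDimQ graph325c l = (B3Sect3LowestOrderGraphs.g325c nbar hn).deg 3 := by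
  rw [Fin.sum_univ_one, lineDimQ_graph325c, B3Sect3LowestOrderGraphs.g325c_deg]
  norm_num [graph325c]

/-- The two degree counts of the tree agree for (3.25)₄. [cite: Balaban1983Higgs3, (3.25) p.439] -/
theorem wholeDeg_graph325d_eq_deg (nbar : ℕ) (hn : 2 ≤ nbar) :
    (graph325d.etaPow 0 : ℚ) + ∑ l, lineDimQ graph325d l = (B3Sect3LowestOrderGraphs.g325d nbar hn).deg 3 := by
  rw [Fin.sum_univ_one, lineDimQ_graph325d, B3Sect3LowestOrderGraphs.g325d_deg]
  norm_num [graph325d]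

end Members

/-! ## §2 The pictures as expressions: (3.8) = (3.6)₁ + (3.7)₁, and (3.30) term by term -/

section Expressions

open B3Sect3ScalarSelfEnergy B3Sect3Subtraction319
open B3Sect3VectorSelfEnergy (lhs326 curly2 Pi2 Pi3 eq326 bracket326_eq_Pi2 curly1_eq_Pi3)

open scoped RealInnerProductSpace

noncomputable section

variable {P : Params} {j : ℕ} {W : Type*} [NormedAddCommGroup W] [InnerProductSpace ℝ W]

/-- **The kernel Σ(x,x′) of the graph (3.6)₁** (the graph drawn in (3.8)), with values in the linear maps of the internal space:
`Σ₃₉(x,x′) = c(x,x′)·q²`, `c(x,x′) = Σ_μ(∂^η_μG_{(j)}(0)∂^{η*}_μ)(x,x′)g(x)G_{(j′)}(x,x′)g′(x′)` = r15's `coeff39` (the square bracket of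
(3.9) is `q c(x,x′) q`). [cite: Balaban1983Higgs3, (3.9) p.435] -/
def sigma39 (η : ℝ) (q : W →ₗ[ℝ] W) (Gj Gj' : Kernel P j) (g g' : SiteField P j ℝ) : Site P j → Site P j → W →ₗ[ℝ] W :=
  fun x x' => coeff39 η Gj Gj' g g' x x' • (q ∘ₗ q)

/-- **(3.6)₁ and (3.7)₁ as expressions**: r15's graph-with-counterterm form (3.19) at the kernel of (3.6)₁ — graph term with the
legs at `x, x′`, minus the counterterm *"represented by the same graph G but with both external legs localized in x and with the
summation over x′"* (p. 417) — has graph term `graphTerm39` and counterterm `counterTerm39` of r15's (3.9).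
[cite: Balaban1983Higgs3, (3.7) p.435] -/
theorem subtracted319_sigma39 (η : ℝ) (q : W →ₗ[ℝ] W) (Gj Gj' : Kernel P j) (g g' : SiteField P j ℝ)
    (φ φ' : SiteField P j W) :
    subtracted319 η (sigma39 η q Gj Gj' g g') φ φ' =
      graphTerm39 η q Gj Gj' g g' φ φ' - counterTerm39 η q Gj Gj' g g' φ φ' := by
  unfold subtracted319 graphTerm39 counterTerm39 sigma39
  congr 1
  · refine Finset.sum_congr rfl fun x _ => Finset.sum_congr rfl fun x' _ => ?_
    simp only [LinearMap.smul_apply, LinearMap.coe_comp, Function.comp_apply, real_inner_smul_right]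
  · refine Finset.sum_congr rfl fun x _ => ?_
    simp only [LinearMap.sum_apply, LinearMap.smul_apply, LinearMap.coe_comp, Function.comp_apply, inner_sum,
      real_inner_smul_right, Finset.mul_sum]
    refine Finset.sum_congr rfl fun x' _ => ?_
    rw [two_mul, pow_add]
    ring

/-- **The picture (3.8) = (3.6)₁ − (counterterm (3.7)₁) has the expression (3.9)**: r15's `expr39` IS minus the
graph-with-counterterm form of the kernel `Σ₃₉` of (3.6)₁ (the exterior sign of the second-order term: (3.9) opens with
"−Σ_{x,x′} …"). [cite: Balaban1983Higgs3, (3.9) p.435] -/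
theorem expr39_eq_neg_subtracted319 (η : ℝ) (q : W →ₗ[ℝ] W) (Gj Gj' : Kernel P j) (g g' : SiteField P j ℝ)
    (φ φ' : SiteField P j W) :
    expr39 η q Gj Gj' g g' φ φ' = -subtracted319 η (sigma39 η q Gj Gj' g g') φ φ' := by
  rw [subtracted319_sigma39, expr39]
  ring

/-- **(3.30) term by term in the scale indices** p. 442 [PDF 32]: the sum of the four graphs (3.25) (r15's `lhs326` = −T₁ + T₂ −
T₃ − T₄ of (3.26) at fixed `j, j′, j″`) EQUALS [the local two-vector-leg vertex ∿×∿ with coefficient `Π_{μμ′}(x)`] + [the local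
vertex ∿×→∿ with coefficient `Π_{μμ′ν}(x)` and the differentiated leg `∂^η_ν(g′A′_{μ′})`] + [the two generalized graphs `+(1+α),
−(1+α)`: the pairing of the combined kernel with the Taylor remainder leg `R` of (3.10), r15's `curly2`] — r15's `eq326` regrouped
through `bracket326_eq_Pi2` and `curly1_eq_Pi3` (Taylor's formula (3.10) for the leg g′A′_{μ′} as the hypothesis `hT`, as there).
The printed coefficients of the two vertices arise after the resummation over `j, j′, j″ ≤ j₀` and (3.27)–(3.29) (other cells of the
row). [cite: Balaban1983Higgs3, (3.30) p.442] -/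
theorem eq330_termwise (η τ : ℝ) (Gj Gj' Gj'' : Kernel P j) (g g' : SiteField P j ℝ) (A A' : VecField P j ℝ)
    (dx : Fin P.d → Site P j → Site P j → ℝ) (D : Fin P.d → Fin P.d → SiteField P j ℝ)
    (R : Fin P.d → Site P j → Site P j → ℝ)
    (hT : ∀ (μ' : Fin P.d) (x x' : Site P j),
      g' x' * A' ⟨x', μ'⟩ = g' x * A' ⟨x, μ'⟩ + (∑ ν : Fin P.d, dx ν x x' * D ν μ' x) + R μ' x x') :
    lhs326 η τ Gj Gj' Gj'' g g' A A' =
      (∑ x : Site P j, η ^ P.d * ∑ μ : Fin P.d, ∑ μ' : Fin P.d,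
          g x * A ⟨x, μ⟩ * Pi2 η τ Gj Gj' Gj'' μ μ' x * (g' x * A' ⟨x, μ'⟩)) +
        (∑ ν : Fin P.d, ∑ x : Site P j, η ^ P.d * ∑ μ : Fin P.d, ∑ μ' : Fin P.d,
          g x * A ⟨x, μ⟩ * Pi3 η τ Gj Gj' dx μ μ' ν x * D ν μ' x) +
        curly2 η τ Gj Gj' g A R := by
  rw [eq326 η τ Gj Gj' Gj'' g g' A A' dx D R hT, bracket326_eq_Pi2, curly1_eq_Pi3]

end

end Expressions

end Literature.MathematicalPhysics.QuantumFieldTheory.Balaban1983to89.B3Eq330Members
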